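import Mathlib
import Literature.NumberTheory.Transcendental.KZCalculus

/-!
# Crux `TypeOneIdentities` (stmt-KontsevichZagierPeriods-11368), line `birth`, stub V `stub_discRepValue`

Bookkeeping stub of the registered skeleton `Lines/birth.lean` of the crux
`ComplexOrientations.TypeOneIdentities`: an integrand-`1` representation of the open disc
`{v | v 0 ^ 2 + v 1 ^ 2 < β}` (`β ≥ 0`) has value `π β`. Its value is the Lebesgue measure of the disc in
`Fin 2 → ℝ`, computed through the volume-preserving identification with `EuclideanSpace ℝ (Fin 2)`
(`PiLp.volume_preserving_toLp`, `EuclideanSpace.volume_ball_fin_two`). Folklore; no definitions.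
-/

noncomputable section

open MeasureTheory Set
open Literature.NumberTheory.Transcendental

namespace Summit.KontsevichZagierPeriods.ComplexOrientations.TypeOneIdentities

/-- **Area of the open disc** `{w : Fin 2 → ℝ | w 0 ² + w 1 ² < β}` (`β ≥ 0`) is `π β` (through Mathlib's
`EuclideanSpace.volume_ball_fin_two` and the volume-preserving `PiLp.volume_preserving_toLp`). [folklore] -/
theorem volume_disc {β : ℝ} (hβ : 0 ≤ β) :
    volume {w : Fin 2 → ℝ | w 0 ^ 2 + w 1 ^ 2 < β} = ENNReal.ofReal (Real.pi * β) := by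
  have hmp := PiLp.volume_preserving_toLp (Fin 2)
  have hset : {w : Fin 2 → ℝ | w 0 ^ 2 + w 1 ^ 2 < β} =
      (WithLp.toLp 2) ⁻¹' Metric.ball (0 : EuclideanSpace ℝ (Fin 2)) (Real.sqrt β) := by
    ext w
    simp [EuclideanSpace.ball_zero_eq (Real.sqrt β) (Real.sqrt_nonneg β), Fin.sum_univ_two,
      Real.sq_sqrt hβ]
  rw [hset, hmp.measure_preimage measurableSet_ball.nullMeasurableSet,
    EuclideanSpace.volume_ball_fin_two, ← ENNReal.ofReal_pow (Real.sqrt_nonneg β), Real.sq_sqrt hβ,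
    ← ENNReal.ofReal_mul hβ, mul_comm]

/-- **Stub V — `discRepValue` (bookkeeping).** An integrand-`1` representation of the open disc
`{x² + y² < β}` (`β ≥ 0`) has value `π β`: the set integral of a function equal to `1` on the domain is
the (finite) measure of the domain (`volume_disc`). [folklore] -/
theorem stub_discRepValue :
    ∀ (β : ℝ) (e : Literature.NumberTheory.Transcendental.KZ.IntegralRep 2), 0 ≤ β → e.domain = {v : Fin 2 → ℝ | v 0 ^ 2 + v 1 ^ 2 < β} → (∀ v ∈ e.domain, e.integrand v = 1) → e.value = Real.pi * β := by
  intro β e hβ hed hei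
  have hmeas : MeasurableSet e.domain := KZ.IntegralRep.measurableSet_domain_holds e
  unfold KZ.IntegralRep.value
  rw [setIntegral_congr_fun hmeas hei, setIntegral_const, smul_eq_mul, mul_one, Measure.real, hed,
    volume_disc hβ, ENNReal.toReal_ofReal (by positivity)]

end Summit.KontsevichZagierPeriods.ComplexOrientations.TypeOneIdentities

end
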